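import Summits.Ventures.PercRepro.SixFourResidueFourPlaneLineSmall
import Summits.Ventures.PercRepro.SixFourResidueFourPlaneLineTWTable
import Summits.Ventures.PercRepro.SixFourResidueFourPlaneLineTail

/-!
# (6,4) residue, plane-line case — `PlaneLineFourBig` holds

`PlaneLineFourBig` (`SixFourResidueBigPlane.lean`) from the three numeric pieces of the sharp sum form of Lemma TW:
`TWSumSmall` (`g ∈ {11, 12}`, `SixFourResidueFourPlaneLineSmall.lean`), `TWTable` (`13 ≤ g ≤ 100`,
`SixFourResidueFourPlaneLineTWTable.lean`, p3) and `TWTail` (`g ≥ 101`, `SixFourResidueFourPlaneLineTail.lean`), through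
`twSum_of_pieces` and `planeLineFourBig_of_TWSum` (`SixFourResidueFourPlaneLineClauses.lean`).
-/

namespace PercRepro.SixFour

/-- **`PlaneLineFourBig` holds**: `J₄(G) ≥ 0` for every non-generic `G` of rank `4` with `|G| ≥ 10`, no plane
meeting `G` in more than `|G| − 3` points, and some plane meeting `G` in at least `8` points. -/
theorem planeLineFourBig_holds : PlaneLineFourBig :=
  planeLineFourBig_of_TWSum (twSum_of_pieces twSumSmall_holds twTable_holds twTail_holds)

end PercRepro.SixFour
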